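import Mathlib
import HarnessLib
import Summits.ResolutionOfSingularities.ResolutionOfSingularities.Theorems.WildQuotientsWildQuotientResolutionS1aLinesCover

/-!
# S1a — THE LINE-ARRANGEMENT CLASS `L_d`, model level: the product cover in the free model `k[x_none, x′]`, units, divisibilities, points

[OURS · L1 W4.5c · lead-1 g15; R3 `lines_killsIn_two` (RULING R-F15l); continues ✓`…S1aLinesCover` (product cover) through a pinned root model `Ψ`
(✓`Sym.exists_symRootModel`)] — NOT statements of the manuscript; counted 0; AI-level work, weaker than expert review. Crux stmt-ResolutionOfSingularities-17941
`CyclicQuotientFourfolds`, line `s1a-logminvertex` v13 (`stub_reachLowerInFX`).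

With `L_m = a_m x₁′ + b_m x₂′ ∈ k[x_none, x′]`:
* `lines_coverElement_succ_eq` — the cover element `c_{i+1} = ((∏_{m≠i} N_m)^E)T^{dbar}` is `(∏_{m≠i} ∏_j (ℓ̂_m + j·ĉ_m·u₀′s^d))^E` in `R^w`;
* `lines_model_coverElement_succ` — `Ψ(c_{i+1}) = (∏_{m≠i} ∏_j (L_m + j·c_m·x₀′x_none^d))^E`;
* `lines_model_dvd_self` (`∏_{m≠i} L_m ∣ Ψ(c_{i+1})`: the other lines are UNITS on the chart of `ℓᵢ`), `lines_model_dvd_other` (`L_i ∣ Ψ(c_{m+1})` for `m ≠ i`: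
  the transition sections vanish on the component), `lines_prod_erase_mul` (`∏ L_m = (∏_{m≠i} L_m)·L_i`);
* `lines_ab_ne_zero` (`(a_i, b_i) ≠ 0` from non-proportionality, `d ≥ 2`), `lines_model_eval_ne_zero` (the point `x₁′ = b_i, x₂′ = −a_i` of `V(x₀′, L_i)` is off
  `Ψ(c_{i+1}) = 0`).
-/

set_option linter.dupNamespace false

noncomputable section

open Literature.AlgebraicGeometry.Resolution
open scoped LaurentPolynomial
open MvPolynomial
open Summit.ResolutionOfSingularities.ResolutionOfSingularities.Theorems.WildQuotientResolution.S1
open Summit.ResolutionOfSingularities.ResolutionOfSingularities.Theorems.WildQuotientResolution.S1.CoarseChart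
open Summit.ResolutionOfSingularities.ResolutionOfSingularities.Theorems.WildQuotientResolution.S1.BlowupCharts

namespace Summit.ResolutionOfSingularities.ResolutionOfSingularities.Theorems.WildQuotientResolution.S1.KillCert.Lines

variable {k : Type} [Field k] {A : Type} [CommRing A] {d : ℕ} (a b : Fin d → k) (e : A ≃+* MvPolynomial (Fin 4) k) {p : ℕ}
  {m' : ℕ} (mo : Fin m' → ℕ) (𝒜 : (Π j : Fin m', ZMod (mo j)) → AddSubgroup A) [GradedRing 𝒜]
  {dbar : ℕ} (y : ↥(𝒜 0)) (hy : y ∈ (traceFiltration 𝒜 (e.symm ∘ ![X 0, X 1, X 2] : Fin 3 → A) ![d + 1, 1, 1]).ideal dbar)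

/-- **The cover element `c_{i+1}` in `R^w`**: `((∏_{m≠i} N_m)^E)T^{dbar} = (∏_{m≠i} ∏_j (ℓ̂_m + j·ĉ_m·u₀′s^d))^E` (`dbar = E(d−1)p`). -/
theorem lines_coverElement_succ_eq [NeZero p] (E : ℕ) (hdbar : (dbar : ℤ) = (E : ℤ) * ((d - 1 : ℕ) : ℤ) * (p : ℤ)) (i : Fin d)
    (hyval : (y : A) = (∏ m ∈ Finset.univ.erase i, ∏ j : ZMod p, (e.symm (C (a m) * X 1 + C (b m) * X 2) + (j.val : A) * e.symm (C (a m + b m) * X 0))) ^ E) :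
    coverElement 𝒜 (e.symm ∘ ![X 0, X 1, X 2] : Fin 3 → A) ![d + 1, 1, 1] dbar y hy =
      (∏ m ∈ Finset.univ.erase i, ∏ j : ZMod p,
        ((algebraMap A _ (e.symm (C (a m))) * cobordantAlgebra.u' (e.symm ∘ ![X 0, X 1, X 2] : Fin 3 → A) ![d + 1, 1, 1] 1 +
            algebraMap A _ (e.symm (C (b m))) * cobordantAlgebra.u' (e.symm ∘ ![X 0, X 1, X 2] : Fin 3 → A) ![d + 1, 1, 1] 2) +
          algebraMap A _ ((j.val : A) * e.symm (C (a m + b m))) *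
            (cobordantAlgebra.u' (e.symm ∘ ![X 0, X 1, X 2] : Fin 3 → A) ![d + 1, 1, 1] 0 * cobordantAlgebra.s (e.symm ∘ ![X 0, X 1, X 2] : Fin 3 → A) ![d + 1, 1, 1] ^ d))) ^ E := by
  have hu0coe : ((cobordantAlgebra.u' (e.symm ∘ ![X 0, X 1, X 2] : Fin 3 → A) ![d + 1, 1, 1] 0 : ↥(cobordantAlgebra (e.symm ∘ ![X 0, X 1, X 2] : Fin 3 → A) ![d + 1, 1, 1])) : A[T;T⁻¹]) =
      LaurentPolynomial.C (e.symm (X 0)) * LaurentPolynomial.T ((d + 1 : ℕ) : ℤ) := by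
    rw [cobordantAlgebra.coe_u']; rfl
  symm
  refine Subtype.ext ?_
  rw [SubmonoidClass.coe_pow, SubmonoidClass.coe_finsetProd, coe_coverElement, hyval, map_pow]
  have hm : ∀ m : Fin d, ((∏ j : ZMod p,
      ((algebraMap A _ (e.symm (C (a m))) * cobordantAlgebra.u' (e.symm ∘ ![X 0, X 1, X 2] : Fin 3 → A) ![d + 1, 1, 1] 1 +
          algebraMap A _ (e.symm (C (b m))) * cobordantAlgebra.u' (e.symm ∘ ![X 0, X 1, X 2] : Fin 3 → A) ![d + 1, 1, 1] 2) +
        algebraMap A _ ((j.val : A) * e.symm (C (a m + b m))) *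
          (cobordantAlgebra.u' (e.symm ∘ ![X 0, X 1, X 2] : Fin 3 → A) ![d + 1, 1, 1] 0 * cobordantAlgebra.s (e.symm ∘ ![X 0, X 1, X 2] : Fin 3 → A) ![d + 1, 1, 1] ^ d)) :
        ↥(cobordantAlgebra (e.symm ∘ ![X 0, X 1, X 2] : Fin 3 → A) ![d + 1, 1, 1])) : A[T;T⁻¹]) =
      LaurentPolynomial.C (∏ j : ZMod p, (e.symm (C (a m) * X 1 + C (b m) * X 2) + (j.val : A) * e.symm (C (a m + b m) * X 0))) * LaurentPolynomial.T (p : ℤ) := by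
    intro m
    rw [SubmonoidClass.coe_finsetProd, lines_norm_T a b e m]
    refine Finset.prod_congr rfl fun j _ => ?_
    rw [AddMemClass.coe_add, MulMemClass.coe_mul, MulMemClass.coe_mul, ← lines_Lhat_eq a b e m, hu0coe, cobordantAlgebra.coe_s_pow, cobordantAlgebra.coe_algebraMap,
      map_mul, map_natCast]
    push_cast
    ring
  simp_rw [hm]
  rw [Finset.prod_mul_distrib, ← map_prod, Finset.prod_const, Finset.card_erase_of_mem (Finset.mem_univ i), Finset.card_univ, Fintype.card_fin,
    LaurentPolynomial.T_pow, mul_pow, ← map_pow, LaurentPolynomial.T_pow, hdbar]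
  congr 2
  ring

variable (Ψ : ↥(cobordantAlgebra (e.symm ∘ ![X 0, X 1, X 2] : Fin 3 → A) ![d + 1, 1, 1]) ≃+* MvPolynomial (Option (Fin 4)) k)
  (hΨa : ∀ q : MvPolynomial (Fin 4) k, Ψ (algebraMap A _ (e.symm q)) = cobordantAlgebra.subst k (![d + 1, 1, 1, 0] : Fin 4 → ℕ) q)
  (hΨs : Ψ (cobordantAlgebra.s _ _) = X none)
  (hΨ0 : Ψ (cobordantAlgebra.u' (e.symm ∘ ![X 0, X 1, X 2] : Fin 3 → A) ![d + 1, 1, 1] 0) = X (some 0))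
  (hΨ1 : Ψ (cobordantAlgebra.u' (e.symm ∘ ![X 0, X 1, X 2] : Fin 3 → A) ![d + 1, 1, 1] 1) = X (some 1))
  (hΨ2 : Ψ (cobordantAlgebra.u' (e.symm ∘ ![X 0, X 1, X 2] : Fin 3 → A) ![d + 1, 1, 1] 2) = X (some 2))

include hΨa hΨs hΨ0 hΨ1 hΨ2 in
/-- ★ **The product cover in the free model**: `Ψ(c_{i+1}) = (∏_{m≠i} ∏_j (L_m + j·c_m·x₀′·x_none^d))^E`. -/
theorem lines_model_coverElement_succ [NeZero p] (E : ℕ) (hdbar : (dbar : ℤ) = (E : ℤ) * ((d - 1 : ℕ) : ℤ) * (p : ℤ)) (i : Fin d)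
    (hyval : (y : A) = (∏ m ∈ Finset.univ.erase i, ∏ j : ZMod p, (e.symm (C (a m) * X 1 + C (b m) * X 2) + (j.val : A) * e.symm (C (a m + b m) * X 0))) ^ E) :
    Ψ (coverElement 𝒜 (e.symm ∘ ![X 0, X 1, X 2] : Fin 3 → A) ![d + 1, 1, 1] dbar y hy) =
      (∏ m ∈ Finset.univ.erase i, ∏ j : ZMod p, ((C (a m) * X (some 1) + C (b m) * X (some 2)) + (j.val : MvPolynomial (Option (Fin 4)) k) * (C (a m + b m) * (X (some 0) * X none ^ d)))) ^ E := by
  have hCa : ∀ c : k, Ψ (algebraMap A _ (e.symm (C c))) = C c := fun c => by rw [hΨa, cobordantAlgebra.subst, MvPolynomial.eval₂Hom_C]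
  rw [lines_coverElement_succ_eq a b e mo 𝒜 y hy E hdbar i hyval, map_pow, map_prod]
  refine congrArg (· ^ E) (Finset.prod_congr rfl fun m _ => ?_)
  rw [map_prod]
  refine Finset.prod_congr rfl fun j _ => ?_
  simp only [map_add, map_mul, map_pow, map_natCast, hCa, hΨ1, hΨ2, hΨ0, hΨs]
  ring

/-- `(∏_{m≠i} L_m) · L_i = ∏_m L_m`. -/
theorem lines_prod_erase_mul (i : Fin d) :
    (∏ m : Fin d, (C (a m) * X (some 1) + C (b m) * X (some 2) : MvPolynomial (Option (Fin 4)) k)) =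
      (∏ m ∈ Finset.univ.erase i, (C (a m) * X (some 1) + C (b m) * X (some 2) : MvPolynomial (Option (Fin 4)) k)) * (C (a i) * X (some 1) + C (b i) * X (some 2)) :=
  (Finset.prod_erase_mul _ _ (Finset.mem_univ i)).symm

/-- **The other lines are units on the chart of `ℓᵢ`**: `∏_{m≠i} L_m ∣ (∏_{m≠i} ∏_j (L_m + j·c_m·x₀′x_none^d))^E` (`E ≠ 0`). -/
theorem lines_model_dvd_self [NeZero p] (E : ℕ) (hE : E ≠ 0) (i : Fin d) :
    (∏ m ∈ Finset.univ.erase i, (C (a m) * X (some 1) + C (b m) * X (some 2) : MvPolynomial (Option (Fin 4)) k)) ∣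
      (∏ m ∈ Finset.univ.erase i, ∏ j : ZMod p, ((C (a m) * X (some 1) + C (b m) * X (some 2)) + (j.val : MvPolynomial (Option (Fin 4)) k) * (C (a m + b m) * (X (some 0) * X none ^ d)))) ^ E := by
  refine Dvd.dvd.trans ?_ (dvd_pow_self _ hE)
  refine Finset.prod_dvd_prod_of_dvd _ _ fun m _ => ?_
  have h0 : (C (a m) * X (some 1) + C (b m) * X (some 2) : MvPolynomial (Option (Fin 4)) k) =
      (C (a m) * X (some 1) + C (b m) * X (some 2)) + ((0 : ZMod p).val : MvPolynomial (Option (Fin 4)) k) * (C (a m + b m) * (X (some 0) * X none ^ d)) := by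
    rw [ZMod.val_zero, Nat.cast_zero, zero_mul, add_zero]
  conv_lhs => rw [h0]
  exact Finset.dvd_prod_of_mem (fun j : ZMod p => (C (a m) * X (some 1) + C (b m) * X (some 2)) + (j.val : MvPolynomial (Option (Fin 4)) k) * (C (a m + b m) * (X (some 0) * X none ^ d)))
    (Finset.mem_univ _)

/-- **The transition sections vanish on the component**: `L_i ∣ (∏_{m≠m₀} ∏_j (…))^E` whenever `i ≠ m₀` (`E ≠ 0`). -/
theorem lines_model_dvd_other [NeZero p] (E : ℕ) (hE : E ≠ 0) (i m₀ : Fin d) (him : i ≠ m₀) :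
    (C (a i) * X (some 1) + C (b i) * X (some 2) : MvPolynomial (Option (Fin 4)) k) ∣
      (∏ m ∈ Finset.univ.erase m₀, ∏ j : ZMod p, ((C (a m) * X (some 1) + C (b m) * X (some 2)) + (j.val : MvPolynomial (Option (Fin 4)) k) * (C (a m + b m) * (X (some 0) * X none ^ d)))) ^ E := by
  refine Dvd.dvd.trans ?_ (lines_model_dvd_self (k := k) a b (p := p) E hE m₀)
  exact Finset.dvd_prod_of_mem (fun m : Fin d => (C (a m) * X (some 1) + C (b m) * X (some 2) : MvPolynomial (Option (Fin 4)) k)) (Finset.mem_erase.mpr ⟨him, Finset.mem_univ i⟩)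

/-- Non-proportional lines (`d ≥ 2`) are nonzero: `a_i ≠ 0 ∨ b_i ≠ 0`. -/
theorem lines_ab_ne_zero (hd : 2 ≤ d) (hprop : ∀ i j : Fin d, i ≠ j → a i * b j ≠ a j * b i) (i : Fin d) : a i ≠ 0 ∨ b i ≠ 0 := by
  by_contra h
  push Not at h
  obtain ⟨ha, hb⟩ := h
  have hj : ∃ j : Fin d, j ≠ i := by
    by_cases hi : (i : ℕ) = 0
    · exact ⟨⟨1, by omega⟩, fun h => by have := congrArg Fin.val h; simp [hi] at this⟩
    · exact ⟨⟨0, by omega⟩, fun h => hi (by have := congrArg Fin.val h; simpa using this.symm)⟩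
  obtain ⟨j, hji⟩ := hj
  exact hprop i j (Ne.symm hji) (by rw [ha, hb, zero_mul, mul_zero])

/-- ★ **A point of `V(x₀′, L_i)` off `Ψ(c_{i+1}) = 0`**: `x₁′ = b_i`, `x₂′ = −a_i`, all other coordinates `0`. -/
theorem lines_model_eval_ne_zero [NeZero p] (hprop : ∀ i j : Fin d, i ≠ j → a i * b j ≠ a j * b i) (E : ℕ) (i : Fin d) :
    MvPolynomial.eval (fun o : Option (Fin 4) => if o = some 1 then b i else if o = some 2 then -a i else 0)
      ((∏ m ∈ Finset.univ.erase i, ∏ j : ZMod p, ((C (a m) * X (some 1) + C (b m) * X (some 2)) + (j.val : MvPolynomial (Option (Fin 4)) k) * (C (a m + b m) * (X (some 0) * X none ^ d)))) ^ E) ≠ 0 := by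
  rw [map_pow]
  refine pow_ne_zero _ ?_
  rw [map_prod]
  refine Finset.prod_ne_zero_iff.mpr fun m hm => ?_
  rw [map_prod]
  refine Finset.prod_ne_zero_iff.mpr fun j _ => ?_
  have hne : m ≠ i := Finset.ne_of_mem_erase hm
  have h1 : (some 0 : Option (Fin 4)) ≠ some 1 := by decide
  have h2 : (some 0 : Option (Fin 4)) ≠ some 2 := by decide
  have h3 : (some 2 : Option (Fin 4)) ≠ some 1 := by decide
  have h4 : (some 1 : Option (Fin 4)) ≠ some 2 := by decide
  simp only [map_add, map_mul, map_natCast, MvPolynomial.eval_C, MvPolynomial.eval_X, map_pow, if_true, if_neg h1, if_neg h2, if_neg h3,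
    if_neg h4, zero_mul, mul_zero, add_zero]
  intro h
  apply hprop m i hne
  linear_combination h

end Summit.ResolutionOfSingularities.ResolutionOfSingularities.Theorems.WildQuotientResolution.S1.KillCert.Lines

end
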